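import Literature.MathematicalPhysics.QuantumFieldTheory.Balaban1983to89.B9Thm311FlippedBondLetters
import Literature.MathematicalPhysics.QuantumFieldTheory.Balaban1983to89.Node00.OpsYTransport

/-!
# `Balaban1983to89.B9Eq3132TentCurl` — T. Bałaban, *Propagators for lattice gauge theories in a background field*, Commun. Math. Phys. **99** (1985) 389–434
# [Balaban1985BackgroundPropagators], (3.4) p. 391 with (3.40) p. 397 and (3.13) p. 393: THE COVARIANT CURL OF A TRANSPORTED TENT — flat curl of the profile, transported,
# plus LASSO DEFECTS `(R(W) − 1)` of def-Y's taxicab transporters (the covariant-difference step F-a of the (P′1) roadmap)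

statement-level skeleton of published theorems with citation tags; proofs where landed; nothing here is a claim about the Yang–Mills mass gap

THE PRINT.  (3.4) p. 391 (the covariant curl `(D_UA)(p)` with the transporters of (3.2)); (3.40) p. 397 (transport along shortest contours `Γ_{x,x′}`); (3.13) p. 393 (`Q(U)`).

WHY THIS FILE (dag-n06-i gen 13, N06 bundle F4, row 26).  The one displayed binder `hP1` of row 26 (ed. 12, `B9Eq3132CoerciveFromEnergy.hco26_of_energy_step12`) is the
`Δ_a(U)`-energy of the transported tent bumps `tentOp (bumpProfile)`; by `B9Eq3132EnergyUpper` it is governed by `‖D_U(TΨ)‖²`, `‖D\*_U(TΨ)‖²`, `‖Q(U)TΨ‖²_w`.  A tent of the index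
bond `y` is the field `b ↦ θ_y(b)·R(τ(b₋))⁻¹X` with `τ(z) = parBY i U x z` (the taxicab transporter from the block corner `x`) and `X = Λ_yΨ(y)`.  THIS FILE computes its
covariant curl EXACTLY: `(D_UA)(p) = c_f·R(τ(p₀))⁻¹[(∂θ)(p)·X + θ(b₂)(R(W_μ)X − X) − θ(b₃)(R(W_ν)X − X)]` where `∂θ` is the flat curl of the profile and
`W_κ = τ(p₀)·U_κ(p₀)·τ(p₀+e_κ)⁻¹` are the taxicab LASSOS of `B9Eq340TaxiForward` (bounded there by the swept plaquette defects): the flat part is the tree's bump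
gradient, the rest is `O(‖W − 1‖)`.

WHAT IS PROVED (sorry-free).
* §1 `sum_curlK_smul` (the curl kernel picks the four contour bonds: `Σ_b ∂(p,b)·F(b) = c_f(F(b₁) + F(b₂) − F(b₃) − F(b₄))`, n06-j's `curlK_eq_of_edge`), the four transporters
  `curlT_edge₁ … curlT_edge₄` (`1, U_μ(p₀), U_ν(p₀), 1`).
* §2 `tentField θ x U X` (one transported tent), ★★★ `curlY_tentField` (the displayed identity), `tentOp_summand_eq_tentField` (C1's `tentOp` summands are these tents).
* §3 `divK_eq`, `sum_divK_smul` (the divergence kernel picks the `2d` bonds at a site), `gradT_tgt ∕ gradT_src`, ★★★ `divY_tentField` — `(D\*_UA)(z) = c_f·R(τ(x))⁻¹Σ_κ[θ⟨x−e_κ,κ⟩R(W_κ(x−e_κ))⁻¹X − θ⟨x,κ⟩X]`.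

HONEST SCOPE.  Exact finite algebra over def-Y's letters; no estimate; count-neutral; N06 NOT discharged.  Cell `pub-ymgap` (HUMAN RULING D-0062), Track A node N06 [B9], seat
`pub-ymgap-dag-n06-i` (gen 13), 2026-08-27; a NEW file.
-/

noncomputable section

namespace Literature.MathematicalPhysics.QuantumFieldTheory.Balaban1983to89.B9Eq3132TentCurl

open Node00
open B6KLevelCensusIndexV1 (KIdx)
open B6GlobalChartV1 (PV)
open B9Eq39Adjoint (R R_add R_sub R_mul R_one R_smul R_zero)
open B9Thm311FlippedBondLetters (curlK_eq_of_edge)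
open B9Eq335CoverageAtLettersY (shift_ne_self)
open B15DeterminingSets (embIter)
open scoped Matrix.Norms.L2Operator

variable {𝔸 : Type} [NormedRing 𝔸] [NormedAlgebra ℂ 𝔸] [CompleteSpace 𝔸]
variable {d ℓ : ℕ} {hd : 1 ≤ d + 1} {hL : Odd (ℓ + 1) ∧ 1 < ℓ + 1} {b₀ b₁ : ℝ} (i : KIdx d ℓ hd hL b₀ b₁)

/-! ## §1 The curl kernel and the curl transporters on the four contour bonds -/

omit [CompleteSpace 𝔸] in
/-- **THE CURL KERNEL PICKS THE FOUR CONTOUR BONDS**: `Σ_b ∂(p, b)·F(b) = c_f·(F⟨p₀,μ⟩ + F⟨p₀+e_μ,ν⟩ − F⟨p₀+e_ν,μ⟩ − F⟨p₀,ν⟩)`. [cite: Balaban1985BackgroundPropagators, (3.4) p.391] -/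
theorem sum_curlK_smul (p : PlaqY i) (F : FBondY i → 𝔸) :
    ∑ b, ((curlK i p b : ℝ) : ℂ) • F b =
      ((i.cf : ℝ) : ℂ) • (F ⟨p.src, p.μ⟩ + F ⟨p.src.shift p.μ, p.ν⟩ - F ⟨p.src.shift p.ν, p.μ⟩ - F ⟨p.src, p.ν⟩) := by
  classical
  have h : ∀ b, ((curlK i p b : ℝ) : ℂ) • F b = ((i.cf : ℝ) : ℂ) •
      ((if (⟨p.src, p.μ⟩ : FBondY i) = b then F b else 0) + (if (⟨p.src.shift p.μ, p.ν⟩ : FBondY i) = b then F b else 0)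
        - (if (⟨p.src.shift p.ν, p.μ⟩ : FBondY i) = b then F b else 0) - (if (⟨p.src, p.ν⟩ : FBondY i) = b then F b else 0)) := by
    intro b
    rw [curlK_eq_of_edge, Complex.ofReal_mul, mul_smul]
    congr 1
    simp only [Complex.ofReal_add, Complex.ofReal_sub, apply_ite Complex.ofReal, Complex.ofReal_one, Complex.ofReal_zero, add_smul, sub_smul, ite_smul,
      one_smul, zero_smul]
  simp_rw [h]
  rw [← Finset.smul_sum, Finset.sum_sub_distrib, Finset.sum_sub_distrib, Finset.sum_add_distrib, Finset.sum_ite_eq, Finset.sum_ite_eq, Finset.sum_ite_eq,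
    Finset.sum_ite_eq]
  simp only [Finset.mem_univ, if_true]

/-- the contour bond `⟨p₀, μ⟩` is transported by `1`. [cite: Balaban1985BackgroundPropagators, (3.2), (3.4) pp.390–391] -/
theorem curlT_edge₁ (U : CfgY 𝔸 i) (p : PlaqY i) : curlT i U p ⟨p.src, p.μ⟩ = 1 := by
  unfold curlT
  have h1 : (⟨p.src, p.μ⟩ : FBondY i) ≠ ⟨p.src.shift p.μ, p.ν⟩ := fun h => (ne_of_lt p.hμν) (congrArg PBond.dir h)
  have h2 : (⟨p.src, p.μ⟩ : FBondY i) ≠ ⟨p.src.shift p.ν, p.μ⟩ := fun h => shift_ne_self i p.src p.ν (congrArg PBond.src h).symm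
  rw [if_neg h1, if_neg h2]

/-- the contour bond `⟨p₀+e_μ, ν⟩` is transported by `U_μ(p₀)`. [cite: Balaban1985BackgroundPropagators, (3.2), (3.4) pp.390–391] -/
theorem curlT_edge₂ (U : CfgY 𝔸 i) (p : PlaqY i) : curlT i U p ⟨p.src.shift p.μ, p.ν⟩ = U p.μ p.src := by
  unfold curlT; rw [if_pos rfl]

/-- the contour bond `⟨p₀+e_ν, μ⟩` is transported by `U_ν(p₀)`. [cite: Balaban1985BackgroundPropagators, (3.2), (3.4) pp.390–391] -/
theorem curlT_edge₃ (U : CfgY 𝔸 i) (p : PlaqY i) : curlT i U p ⟨p.src.shift p.ν, p.μ⟩ = U p.ν p.src := by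
  unfold curlT
  have h1 : (⟨p.src.shift p.ν, p.μ⟩ : FBondY i) ≠ ⟨p.src.shift p.μ, p.ν⟩ := fun h => (ne_of_lt p.hμν) (congrArg PBond.dir h)
  rw [if_neg h1, if_pos rfl]

/-- the contour bond `⟨p₀, ν⟩` is transported by `1`. [cite: Balaban1985BackgroundPropagators, (3.2), (3.4) pp.390–391] -/
theorem curlT_edge₄ (U : CfgY 𝔸 i) (p : PlaqY i) : curlT i U p ⟨p.src, p.ν⟩ = 1 := by
  unfold curlT
  have h1 : (⟨p.src, p.ν⟩ : FBondY i) ≠ ⟨p.src.shift p.μ, p.ν⟩ := fun h => shift_ne_self i p.src p.μ (congrArg PBond.src h).symm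
  have h2 : (⟨p.src, p.ν⟩ : FBondY i) ≠ ⟨p.src.shift p.ν, p.μ⟩ := fun h => (ne_of_lt p.hμν) (congrArg PBond.dir h).symm
  rw [if_neg h1, if_neg h2]

/-! ## §2 One transported tent and its covariant curl -/

/-- ★ **ONE TRANSPORTED TENT**: `b ↦ θ(b)·R(τ(b₋))⁻¹X`, `τ(z) = parBY i U x z` (the taxicab transporter from the block corner `x`) — the `y`-th summand of C1's `tentOp` with
`θ = θ_y`, `x = embIter j (src y)`, `X = Λ_yΨ(y)`. [cite: Balaban1985BackgroundPropagators, (3.13) p.393, (3.40) p.397; Balaban1984PropagatorsII, (2.147) p.248] -/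
def tentField (θ : FBondY i → ℝ) (x : Site (PV d ℓ i.m i.K hd hL) 0) (U : CfgY 𝔸 i) (X : 𝔸) : FBondY i → 𝔸 :=
  fun b => ((θ b : ℝ) : ℂ) • R (parBY i U x b.src)⁻¹ X

/-- ★★★ **THE COVARIANT CURL OF A TRANSPORTED TENT**: with `τ(z) = parBY i U x z`, `p = ⟨p₀; μ < ν⟩`, `W_κ := τ(p₀)·U_κ(p₀)·τ(p₀+e_κ)⁻¹` (the taxicab lassos),
`(D_UA)(p) = c_f·R(τ(p₀))⁻¹[(θ⟨p₀,μ⟩ + θ⟨p₀+e_μ,ν⟩ − θ⟨p₀+e_ν,μ⟩ − θ⟨p₀,ν⟩)·X + θ⟨p₀+e_μ,ν⟩·(R(W_μ)X − X) − θ⟨p₀+e_ν,μ⟩·(R(W_ν)X − X)]` — the flat curl of the profile,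
transported, plus the lasso defects. [cite: Balaban1985BackgroundPropagators, (3.4) p.391, (3.40) p.397] -/
theorem curlY_tentField (U : CfgY 𝔸 i) (θ : FBondY i → ℝ) (x : Site (PV d ℓ i.m i.K hd hL) 0) (X : 𝔸) (p : PlaqY i) :
    curlY i U (tentField i θ x U X) p =
      ((i.cf : ℝ) : ℂ) • R (parBY i U x p.src)⁻¹
        ((((θ ⟨p.src, p.μ⟩ + θ ⟨p.src.shift p.μ, p.ν⟩ - θ ⟨p.src.shift p.ν, p.μ⟩ - θ ⟨p.src, p.ν⟩ : ℝ) : ℂ)) • X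
          + ((θ ⟨p.src.shift p.μ, p.ν⟩ : ℝ) : ℂ) • (R (parBY i U x p.src * U p.μ p.src * (parBY i U x (p.src.shift p.μ))⁻¹) X - X)
          - ((θ ⟨p.src.shift p.ν, p.μ⟩ : ℝ) : ℂ) • (R (parBY i U x p.src * U p.ν p.src * (parBY i U x (p.src.shift p.ν))⁻¹) X - X)) := by
  rw [curlY, trLiftY_apply, sum_curlK_smul, curlT_edge₁, curlT_edge₂, curlT_edge₃, curlT_edge₄]
  simp only [tentField, R_one]
  -- transporters: `R(U_κ(p₀))·R(τ(p₀+e_κ))⁻¹ = R(τ(p₀))⁻¹·R(W_κ)`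
  have key : ∀ κ : Fin (PV d ℓ i.m i.K hd hL).d,
      R (U κ p.src) (R (parBY i U x (p.src.shift κ))⁻¹ X) =
        R (parBY i U x p.src)⁻¹ (R (parBY i U x p.src * U κ p.src * (parBY i U x (p.src.shift κ))⁻¹) X) := by
    intro κ
    rw [← B9Eq39Adjoint.R_mul, ← B9Eq39Adjoint.R_mul]
    congr 1
    group
  rw [R_smul, R_smul, key p.μ, key p.ν]
  -- linear algebra over the three atoms `R(τ)⁻¹X`, `R(τ)⁻¹R(W_μ)X`, `R(τ)⁻¹R(W_ν)X`
  set A := R (parBY i U x p.src)⁻¹ X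
  set B := R (parBY i U x p.src)⁻¹ (R (parBY i U x p.src * U p.μ p.src * (parBY i U x (p.src.shift p.μ))⁻¹) X)
  set C := R (parBY i U x p.src)⁻¹ (R (parBY i U x p.src * U p.ν p.src * (parBY i U x (p.src.shift p.ν))⁻¹) X)
  simp only [R_add, R_sub, R_smul]
  push_cast
  module

/-- def-Y∕C1's tent operator IS the sum of the transported tents of the index bonds (`qT parBY U y b = parBY U (embIter j y₋) b₋`).
[cite: Balaban1985BackgroundPropagators, (3.13) p.393; Balaban1984PropagatorsII, (2.147) p.248] -/
theorem tentOp_summand_eq_tentField {N : ℕ} (θ : IBondY i → FBondY i → ℝ) (U : CfgY (Matrix (Fin N) (Fin N) ℂ) i)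
    (Ψ : IBondY i → Matrix (Fin N) (Fin N) ℂ) (y : IBondY i) (b : FBondY i) (Λ : ℝ) :
    θ y b • R (qT i (parBY i) U y b)⁻¹ (Λ • Ψ y) =
      tentField i (θ y) (embIter (y.1.1 : ℕ) y.1.2.src) U (Λ • Ψ y) b := by
  rw [tentField, Complex.coe_smul]
  rfl

/-! ## §3 The covariant divergence of a transported tent -/

omit [NormedAlgebra ℂ 𝔸] [CompleteSpace 𝔸] in
/-- `R(V)` is additive over finite sums. [cite: Balaban1985BackgroundPropagators, (3.3) p.390 («R(U)X = UXU⁻¹»), bookkeeping] -/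
theorem R_finset_sum {ι : Type*} (V : 𝔸ˣ) (s : Finset ι) (f : ι → 𝔸) : R V (∑ k ∈ s, f k) = ∑ k ∈ s, R V (f k) := by
  classical
  induction s using Finset.induction_on with
  | empty => simp
  | insert a s ha ih => rw [Finset.sum_insert ha, Finset.sum_insert ha, R_add, ih]


/-- the divergence kernel in coordinates: `∂*(z, b) = c_f([b₊ = x] − [b₋ = x])`, `x` the torus site of the chart site `z`.
[cite: Balaban1985BackgroundPropagators, (3.8) p.392; Balaban1984PropagatorsII, (2.19) p.226] -/
theorem divK_eq (z : SiteY i) (b : FBondY i) :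
    divK i z b = i.cf * ((if b.tgt = (B6GlobalChartV1.boxEquiv i.hN).symm z then 1 else 0) - (if b.src = (B6GlobalChartV1.boxEquiv i.hN).symm z then 1 else 0)) := by
  rw [divK_eq_transpose, Matrix.transpose_apply, gradK, Matrix.submatrix_apply]
  exact B6AgreeLapV1Chart.toMatrix'_dE _ _ b _

/-- a sum over fine bonds is a double sum over sites and directions. [cite: Balaban1984PropagatorsI, (1.1) p.18, bookkeeping] -/
theorem sum_fbond_eq {α : Type*} [AddCommMonoid α] (F : FBondY i → α) :
    ∑ b : FBondY i, F b = ∑ κ : Fin (PV d ℓ i.m i.K hd hL).d, ∑ s : Site (PV d ℓ i.m i.K hd hL) 0, F ⟨s, κ⟩ := by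
  rw [← Equiv.sum_comp (LatticeFieldCalculus.bondEquiv (P := PV d ℓ i.m i.K hd hL) (j := 0)) F, Fintype.sum_prod_type, Finset.sum_comm]
  rfl

omit [CompleteSpace 𝔸] in
/-- **THE DIVERGENCE KERNEL PICKS THE `2d` BONDS AT A SITE**: `Σ_b ∂*(z,b)·G(b) = c_f·Σ_κ (G⟨x − e_κ, κ⟩ − G⟨x, κ⟩)`. [cite: Balaban1985BackgroundPropagators, (3.8) p.392] -/
theorem sum_divK_smul (z : SiteY i) (G : FBondY i → 𝔸) :
    ∑ b, ((divK i z b : ℝ) : ℂ) • G b =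
      ((i.cf : ℝ) : ℂ) • ∑ κ : Fin (PV d ℓ i.m i.K hd hL).d,
        (G ⟨((B6GlobalChartV1.boxEquiv i.hN).symm z).unshift κ, κ⟩ - G ⟨(B6GlobalChartV1.boxEquiv i.hN).symm z, κ⟩) := by
  classical
  set x := (B6GlobalChartV1.boxEquiv i.hN).symm z with hx
  have h : ∀ b : FBondY i, ((divK i z b : ℝ) : ℂ) • G b =
      ((i.cf : ℝ) : ℂ) • ((if b.tgt = x then G b else 0) - (if b.src = x then G b else 0)) := by
    intro b
    rw [divK_eq, ← hx, Complex.ofReal_mul, mul_smul]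
    congr 1
    simp only [Complex.ofReal_sub, apply_ite Complex.ofReal, Complex.ofReal_one, Complex.ofReal_zero, sub_smul, ite_smul, one_smul, zero_smul]
  simp_rw [h]
  rw [← Finset.smul_sum, Finset.sum_sub_distrib, sum_fbond_eq, sum_fbond_eq, ← Finset.sum_sub_distrib]
  congr 1
  refine Finset.sum_congr rfl fun κ _ => ?_
  have htgt : ∀ s : Site (PV d ℓ i.m i.K hd hL) 0, (PBond.tgt (⟨s, κ⟩ : FBondY i) = x) = (s = x.unshift κ) := fun s => by
    show (s.shift κ = x) = _
    exact propext (LatticeFieldCalculus.shiftEquiv (P := PV d ℓ i.m i.K hd hL) (j := 0) κ).apply_eq_iff_eq_symm_apply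
  simp_rw [htgt]
  rw [Finset.sum_ite_eq' Finset.univ (x.unshift κ), if_pos (Finset.mem_univ _)]
  simp only [Finset.sum_ite_eq', Finset.mem_univ, if_true]

/-- the gradient transporter at the TARGET of a bond is the bond variable, elsewhere `1`. [cite: Balaban1985BackgroundPropagators, (3.3), (3.8) pp.390–392] -/
theorem gradT_tgt (U : CfgY 𝔸 i) (b : FBondY i) : gradT i U b (B6GlobalChartV1.boxEquiv i.hN b.tgt) = U b.dir b.src := by
  unfold gradT; rw [if_pos rfl]

/-- … and at the SOURCE it is `1` (torus period ≥ 2). [cite: Balaban1985BackgroundPropagators, (3.3), (3.8) pp.390–392] -/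
theorem gradT_src (U : CfgY 𝔸 i) (b : FBondY i) : gradT i U b (B6GlobalChartV1.boxEquiv i.hN b.src) = 1 := by
  unfold gradT
  rw [if_neg]
  intro h
  exact shift_ne_self i b.src b.dir ((B6GlobalChartV1.boxEquiv i.hN).injective h).symm

/-- ★★★ **THE COVARIANT DIVERGENCE OF A TRANSPORTED TENT**: with `τ(·) = parBY i U x₀ ·`, at the chart site `z` over the torus site `x`,
`(D\*_UA)(z) = c_f·R(τ(x))⁻¹·Σ_κ [θ⟨x−e_κ,κ⟩·R(W_κ(x−e_κ))⁻¹X − θ⟨x,κ⟩·X]` where `W_κ(w) = τ(w)·U_κ(w)·τ(w+e_κ)⁻¹` — i.e. the flat divergence `Σ_κ(θ⟨x−e_κ,κ⟩ − θ⟨x,κ⟩)`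
transported, plus the lasso defects `θ⟨x−e_κ,κ⟩(R(W_κ(x−e_κ))⁻¹X − X)`. [cite: Balaban1985BackgroundPropagators, (3.8) p.392, (3.40) p.397] -/
theorem divY_tentField (U : CfgY 𝔸 i) (θ : FBondY i → ℝ) (x₀ : Site (PV d ℓ i.m i.K hd hL) 0) (X : 𝔸) (z : SiteY i) :
    divY i U (tentField i θ x₀ U X) z =
      ((i.cf : ℝ) : ℂ) • R (parBY i U x₀ ((B6GlobalChartV1.boxEquiv i.hN).symm z))⁻¹
        (∑ κ : Fin (PV d ℓ i.m i.K hd hL).d,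
          (((θ ⟨((B6GlobalChartV1.boxEquiv i.hN).symm z).unshift κ, κ⟩ : ℝ) : ℂ) •
              R (parBY i U x₀ (((B6GlobalChartV1.boxEquiv i.hN).symm z).unshift κ) * U κ (((B6GlobalChartV1.boxEquiv i.hN).symm z).unshift κ) *
                  (parBY i U x₀ ((B6GlobalChartV1.boxEquiv i.hN).symm z))⁻¹)⁻¹ X
            - ((θ ⟨(B6GlobalChartV1.boxEquiv i.hN).symm z, κ⟩ : ℝ) : ℂ) • X)) := by
  set x := (B6GlobalChartV1.boxEquiv i.hN).symm z with hx
  have hz : z = B6GlobalChartV1.boxEquiv i.hN x := by rw [hx, Equiv.apply_symm_apply]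
  rw [divY, trLiftY_apply, sum_divK_smul, ← hx]
  congr 1
  rw [R_finset_sum]
  refine Finset.sum_congr rfl fun κ _ => ?_
  have htgt : PBond.tgt (⟨x.unshift κ, κ⟩ : FBondY i) = x :=
    (LatticeFieldCalculus.shiftEquiv (P := PV d ℓ i.m i.K hd hL) (j := 0) κ).apply_symm_apply x
  have h1 : gradT i U (⟨x.unshift κ, κ⟩ : FBondY i) z = U κ (x.unshift κ) := by
    have h := gradT_tgt i U ⟨x.unshift κ, κ⟩
    rw [htgt] at h
    rw [hz]; exact h
  have h2 : gradT i U (⟨x, κ⟩ : FBondY i) z = 1 := by rw [hz]; exact gradT_src i U ⟨x, κ⟩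
  rw [h1, h2, inv_one, R_one]
  simp only [tentField, R_sub, R_smul]
  congr 2
  rw [← B9Eq39Adjoint.R_mul, ← B9Eq39Adjoint.R_mul]
  congr 1
  group

end Literature.MathematicalPhysics.QuantumFieldTheory.Balaban1983to89.B9Eq3132TentCurl

end
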